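import Summits.Ventures.HodgeRepro2.T5InertGlobalToLocal
import Summits.Ventures.HodgeRepro2.T5LocalConjugationRestriction

/-!
# T5InertPlaceInertiaTrivial — at an inert place the inertia group is trivial: the local
conjugation acts non-trivially on the residue field (the Galois-theoretic «unramified»)

Tier-5 kernel support (N3, the inert places) — p8, gen 15.  §8(d): uses an L-value-free
non-vanishing device: NO.

The record's «`E_v / F_v` unramified» has three readings already in kernel — `e = 1`
(`T5InertGlobalToLocal`), `f = [E_v : F_v]` (`T5-132`, `T5-138`) — and a third, Galois-theoretic
one: the inertia subgroup of `Gal(E_v / F_v)` acting on `𝒪_{E_v}` is trivial, so the non-trivial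
automorphism `σ` acts non-trivially on the residue field `𝓀(𝒪_{E_v})` (it is the Frobenius of the
quadratic residue extension).  Mathlib's `Ideal.card_inertia_eq_ramificationIdxIn`
(`|inertia| = e`) on the Galois group of `L_w / K_v` acting on `O_Lw` through
`IsIntegralClosure.MulSemiringAction` gives, with `e(w/v) = 1`:
* `card_inertia_eq_one` / `inertia_eq_bot` — the inertia group is trivial;
* `exists_smul_sub_notMem_maximalIdeal` — every `σ ≠ 1` moves some integer modulo `𝔪_w`;
* `exists_residue_smul_ne` — **`σ` acts non-trivially on the residue field of `O_Lw`**;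
* `coe_smul` — the action is the restriction of `σ` to `O_Lw` (`σ • x = σ x` in `L_w`).
-/

namespace Summit.Ventures.HodgeRepro2.T5InertPlaceInertiaTrivial

open IsDedekindDomain HeightOneSpectrum NumberField

variable {K : Type*} [Field K] [NumberField K] (v : HeightOneSpectrum (RingOfIntegers K))
variable {L : Type*} [Field L] [NumberField L] [Algebra K L]
  (w : HeightOneSpectrum (RingOfIntegers L)) [w.asIdeal.LiesOver v.asIdeal]

/-- The action of `Gal(L_w / K_v)` on `O_Lw` (Mathlib's `galRestrict`) is the restriction of `σ`:
`↑(σ • x) = σ ↑x`. -/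
theorem coe_smul (σ : w.adicCompletion L ≃ₐ[v.adicCompletion K] w.adicCompletion L)
    (x : w.adicCompletionIntegers L) :
    letI : MulSemiringAction (w.adicCompletion L ≃ₐ[v.adicCompletion K] w.adicCompletion L)
      (w.adicCompletionIntegers L) :=
      IsIntegralClosure.MulSemiringAction (v.adicCompletionIntegers K) (v.adicCompletion K)
        (w.adicCompletion L) (w.adicCompletionIntegers L)
    ((σ • x : w.adicCompletionIntegers L) : w.adicCompletion L) = σ (x : w.adicCompletion L) :=
  algebraMap_galRestrict_apply (v.adicCompletionIntegers K) σ x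

/-- At an inert place (`e(w/v) = 1`, local degree `2`) the inertia group of `𝔪_w` in
`Gal(L_w / K_v)` has one element (Mathlib's `|inertia| = e`). -/
theorem card_inertia_eq_one (he : v.asIdeal.ramificationIdx' w.asIdeal = 1)
    (h2 : Module.finrank (v.adicCompletion K) (w.adicCompletion L) = 2) :
    letI : MulSemiringAction (w.adicCompletion L ≃ₐ[v.adicCompletion K] w.adicCompletion L)
      (w.adicCompletionIntegers L) :=
      IsIntegralClosure.MulSemiringAction (v.adicCompletionIntegers K) (v.adicCompletion K)
        (w.adicCompletion L) (w.adicCompletionIntegers L)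
    Nat.card (Ideal.inertia (w.adicCompletion L ≃ₐ[v.adicCompletion K] w.adicCompletion L)
      (IsLocalRing.maximalIdeal (w.adicCompletionIntegers L))) = 1 := by
  haveI := T5InertPlaceCompletion.isGalois_adicCompletion v w h2
  letI : MulSemiringAction (w.adicCompletion L ≃ₐ[v.adicCompletion K] w.adicCompletion L)
    (w.adicCompletionIntegers L) :=
    IsIntegralClosure.MulSemiringAction (v.adicCompletionIntegers K) (v.adicCompletion K)
      (w.adicCompletion L) (w.adicCompletionIntegers L)
  haveI : IsGaloisGroup (w.adicCompletion L ≃ₐ[v.adicCompletion K] w.adicCompletion L)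
      (v.adicCompletionIntegers K) (w.adicCompletionIntegers L) :=
    IsGaloisGroup.of_isFractionRing _ _ _ (v.adicCompletion K) (w.adicCompletion L)
  haveI : Finite ((v.adicCompletionIntegers K) ⧸
      IsLocalRing.maximalIdeal (v.adicCompletionIntegers K)) :=
    (inferInstance : Finite (IsLocalRing.ResidueField (v.adicCompletionIntegers K)))
  haveI : (IsLocalRing.maximalIdeal (w.adicCompletionIntegers L)).LiesOver
      (IsLocalRing.maximalIdeal (v.adicCompletionIntegers K)) := inferInstance
  rw [Ideal.card_inertia_eq_ramificationIdxIn (IsLocalRing.maximalIdeal (v.adicCompletionIntegers K))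
      (IsLocalRing.maximalIdeal (w.adicCompletionIntegers L)),
    Ideal.ramificationIdxIn_eq_ramificationIdx _ (IsLocalRing.maximalIdeal (w.adicCompletionIntegers L))
      (w.adicCompletion L ≃ₐ[v.adicCompletion K] w.adicCompletion L),
    ← Ideal.ramificationIdx'_eq_ramificationIdx _ _ (IsDiscreteValuationRing.not_a_field _),
    T5InertGlobalToLocal.ramificationIdx'_maximalIdeal_eq v w, he]

/-- At an inert place the inertia group is trivial. -/
theorem inertia_eq_bot (he : v.asIdeal.ramificationIdx' w.asIdeal = 1)
    (h2 : Module.finrank (v.adicCompletion K) (w.adicCompletion L) = 2) :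
    letI : MulSemiringAction (w.adicCompletion L ≃ₐ[v.adicCompletion K] w.adicCompletion L)
      (w.adicCompletionIntegers L) :=
      IsIntegralClosure.MulSemiringAction (v.adicCompletionIntegers K) (v.adicCompletion K)
        (w.adicCompletion L) (w.adicCompletionIntegers L)
    Ideal.inertia (w.adicCompletion L ≃ₐ[v.adicCompletion K] w.adicCompletion L)
      (IsLocalRing.maximalIdeal (w.adicCompletionIntegers L)) = ⊥ :=
  Subgroup.card_eq_one.1 (card_inertia_eq_one v w he h2)

/-- At an inert place every non-trivial `σ ∈ Gal(L_w / K_v)` moves some integer modulo `𝔪_w`. -/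
theorem exists_smul_sub_notMem_maximalIdeal (he : v.asIdeal.ramificationIdx' w.asIdeal = 1)
    (h2 : Module.finrank (v.adicCompletion K) (w.adicCompletion L) = 2)
    (σ : w.adicCompletion L ≃ₐ[v.adicCompletion K] w.adicCompletion L) (hσ : σ ≠ 1) :
    letI : MulSemiringAction (w.adicCompletion L ≃ₐ[v.adicCompletion K] w.adicCompletion L)
      (w.adicCompletionIntegers L) :=
      IsIntegralClosure.MulSemiringAction (v.adicCompletionIntegers K) (v.adicCompletion K)
        (w.adicCompletion L) (w.adicCompletionIntegers L)
    ∃ x : w.adicCompletionIntegers L,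
      σ • x - x ∉ IsLocalRing.maximalIdeal (w.adicCompletionIntegers L) := by
  letI : MulSemiringAction (w.adicCompletion L ≃ₐ[v.adicCompletion K] w.adicCompletion L)
    (w.adicCompletionIntegers L) :=
    IsIntegralClosure.MulSemiringAction (v.adicCompletionIntegers K) (v.adicCompletion K)
      (w.adicCompletion L) (w.adicCompletionIntegers L)
  by_contra h
  push Not at h
  apply hσ
  have hmem : σ ∈ Ideal.inertia (w.adicCompletion L ≃ₐ[v.adicCompletion K] w.adicCompletion L)
      (IsLocalRing.maximalIdeal (w.adicCompletionIntegers L)) := h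
  rw [inertia_eq_bot v w he h2, Subgroup.mem_bot] at hmem
  exact hmem

/-- **THE LOCAL CONJUGATION ACTS NON-TRIVIALLY ON THE RESIDUE FIELD** at an inert place: for every
`σ ≠ 1` there is an integer `x` with `residue (σ • x) ≠ residue x` (σ̄ is the Frobenius of the
quadratic residue extension; the Galois-theoretic reading of «`E_v / F_v` unramified»). -/
theorem exists_residue_smul_ne (he : v.asIdeal.ramificationIdx' w.asIdeal = 1)
    (h2 : Module.finrank (v.adicCompletion K) (w.adicCompletion L) = 2)
    (σ : w.adicCompletion L ≃ₐ[v.adicCompletion K] w.adicCompletion L) (hσ : σ ≠ 1) :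
    letI : MulSemiringAction (w.adicCompletion L ≃ₐ[v.adicCompletion K] w.adicCompletion L)
      (w.adicCompletionIntegers L) :=
      IsIntegralClosure.MulSemiringAction (v.adicCompletionIntegers K) (v.adicCompletion K)
        (w.adicCompletion L) (w.adicCompletionIntegers L)
    ∃ x : w.adicCompletionIntegers L,
      IsLocalRing.residue (w.adicCompletionIntegers L) (σ • x) ≠
        IsLocalRing.residue (w.adicCompletionIntegers L) x := by
  letI : MulSemiringAction (w.adicCompletion L ≃ₐ[v.adicCompletion K] w.adicCompletion L)
    (w.adicCompletionIntegers L) :=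
    IsIntegralClosure.MulSemiringAction (v.adicCompletionIntegers K) (v.adicCompletion K)
      (w.adicCompletion L) (w.adicCompletionIntegers L)
  obtain ⟨x, hx⟩ := exists_smul_sub_notMem_maximalIdeal v w he h2 σ hσ
  refine ⟨x, fun h => hx ?_⟩
  exact Ideal.Quotient.eq.1 h

end Summit.Ventures.HodgeRepro2.T5InertPlaceInertiaTrivial
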